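/-
Copyright (c) 2026 the pub-hodgecm-mathlib formalisation cell (harness21).  Prover seat hodgecm-mathlib-K2E1-p11 (g4), Track B ∕ K2-LIT, h413 = `stmt-HodgeConjecture-24833`,
R90-TF section S8 «ContSpec-n½», #2 road (G side), S8 dealer R90-CS-plan (g3) S8-R129 (1) «NEXT BY NAME» (census `R90/S8/CENSUS-HEAD3.K2E1-p11-g4.md` a14494c7b38dc692, item (4)): the LEVEL
exhaustion letter (HEAD₃) cut down to the census's N = 3 twins (m1)–(m5) — at every COMPACT level of `U(2,1)_{L∕L⁺}` the orthogonal complement of the cuspidal subspace meets the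
`(K′, ω)`-isotypic subspace in the CLOSED SPAN of the NICE `ω`-equivariant pseudo-Eisenstein classes (★ generic P1b_τ over ★ p863214, the N = 3 world bridge), and the same in the
`Fix(ι_f Kf)` currency of ★ `hHead_kType_of_level_three`'s binder `hHead_level`.
-/
import Summits.HodgeConjecture.HodgeConjecture.Theorems.R90S8CuspOrthogonalLePseudoEisensteinClosureU3         -- ★ p863214 (this seat): `orthogonal_eq_topologicalClosure_span_of_borel_three` (the N = 3 world bridge of ★ f1's density)
import Summits.HodgeConjecture.HodgeConjecture.Theorems.K2E1PseudoEisensteinFamilyDecompositionOpenCosetsNamedU2   -- ★ NAMED″ (K2E1-p10) §0 `exists_haar_probability_invariant` (generic compact group); brings ★ P1b_τ `orthogonal_inf_iInf_eigenspace_eq_topologicalClosure_span_nice` (generic `𝒢`)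
import Literature.NumberTheory.Automorphic.UnitaryGroupKernelFiniteSum                                         -- ★ `isDiscreteRational_quasiSplit` (every `N`)
import HarnessLib

/-!
# S8 #2 road (G side) — `R90S8CuspOrthogonalFixLeNiceSpanU3`: `(L²_cusp(𝔓))ᗮ ⊓ L²(X)^{(K′,ω)} = closure span Θ^{ω,nice}(𝔓, K′)` at every COMPACT level `K′ ≤ U(2,1)(𝔸_{L⁺})`, and
# `(L²_cusp(𝔓))ᗮ ⊓ Fix(ι_f Kf) = closure span Θ^{nice, ι_f(Kf)}(𝔓)` for every compact `Kf ≤ U(2,1)(𝔸_{L⁺,f})` — (HEAD₃) reduced to the nice-class generator core (census (m1)–(m5))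

Track B ∕ K2-LIT, crux h413 = `stmt-HodgeConjecture-24833`, route of record `HCCMUnconditional`; cell `hodgecm-mathlib`, R90-TF programme, section S8 «ContSpec-n½», socket #2's ED. 5
sub-socket (E) (`Lines/R90_S8_ResidualSpectrumU3B.lean` :231).  THEOREMS ONLY (no `def`, no `instance`, no `notation`, no named-fact hypothesis, no `sorry`; default heartbeats); lane
`--supports stmt-HodgeConjecture-24833 --as helper` (count-neutral).  CLOSES NO SOCKET.  WHAT IT PAYS: the LEVEL exhaustion letter (HEAD₃) = binder `hHead_level` of ★ p862893
`hHead_kType_of_level_three` reads «`(cuspidalSubspace μ 𝔓)ᗮ ⊓ Fix(ι_f Kf) ≤ cl ⨆_b resGBlock L μ (Kf.map ι_f) 1 (χ₁ b) (χ₂ b)`» [MW II.2.4]; this file proves, for every compact `Kf`, that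
its LEFT side EQUALS the closed span of the NICE pseudo-Eisenstein classes `[θ_Ψ]` — `Ψ` Borel, right-`N(𝔸)`-invariant, square-integrable sum, CONTINUOUS, BOUNDED, supported in `C·N(𝔸)`
(`C` compact) and LEFT-`ι_f(Kf)`-INVARIANT — so (HEAD₃) is EXACTLY the statement «every such nice class lies in `cl ⨆_b resGBlock (Kf.map ι_f) 1 b`», the N = 3 twin of the E1 C7 HEAD″
generator core ★ p861008 `toLp_pseudoEisenstein_mem_closure_biSup_family_open` (census (m1) Borel periodization along `T(F)`, (m2) Fourier decomposition on the two-character torus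
`T(F)∖T(𝔸)¹`, (m3) open `(B(𝔸), K′)` double cosets, (m4) nice-class `memLp` + band bound, (m5) assembly — NOT claimed here).

THE MATHEMATICS ([MoeglinWaldspurger1995] II.1.1–II.1.4, II.1.12, II.2.4; [DeitmarEchterhoff2014] Prop. 1.5.6, Lemma 7.2.6).  `E := (L²_cusp(𝔓))ᗮ = closure span Θ` (★ p863214, the ★ f1
density in the `quasiSplit` world, `Θ` = square-integrable test class) is also the closed span of the NICE classes (truncation + Dirac smoothing, ★ P1a); for a compact group `K′` acting
through the unitary regular representation with invariant Haar probability `μK` (★ NAMED″ §0) and a continuous unitary character `ω`, the `ω`-isotypic projector `P_ω = ∫_{K′} ω(k)⁻¹ R(k) dμK`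
maps `[θ_Φ]` to `[θ_{Φ^{♮,ω}}]` with `Φ^{♮,ω}` again nice and `ω`-equivariant, whence `E ⊓ L²(X)^{(K′,ω)} = closure span (P_ω Θ^{nice}) = closure span Θ^{ω,nice}` — ★ generic P1b_τ
`orthogonal_inf_iInf_eigenspace_eq_topologicalClosure_span_nice`, which this file instantiates at `𝒢 := quasiSplit L⁺ L c 3` (locally compact, second countable, Hausdorff; `G(F)` discrete ★
`isDiscreteRational_quasiSplit`; the Heisenberg radical closed, §1) exactly as ★ `R90S8ResHLevelFamilySideConditionsU2` §1 does at `N = 2`.  §3 reads the `ω = 1` case at `K′ := ι_f(Kf)` in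
the `Fix(ι_f Kf) = ⨅_{u ∈ Kf} eigenspace(R(ι_f u), 1)` currency of `hHead_level` (re-indexing the infimum along `Kf ↠ ι_f(Kf)`, and `1⁻¹·Φ = Φ` in the invariance clause).
* §1 `isClosed_coe_adelicUnipotent_three` (the Heisenberg radical `N(𝔸) ≤ U(2,1)(𝔸_{L⁺})` is closed).
* §2 **`cuspidal_orthogonal_inf_isotypic_eq_topologicalClosure_span_nice_of_isCompact_three`** — THE `hP1τ` LETTER AT A COMPACT LEVEL OF `U(2,1)_{L∕L⁺}` (every Borel datum `𝔓` with
  non-empty index and radicals `= adelicUnipotent`, every compact `K′ ≤ G(𝔸)`, every continuous unitary `ω : K′ →* ℂ`).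
* §3 **`cuspidal_orthogonal_inf_fixFin_eq_topologicalClosure_span_nice_three`** ∕ **`cuspidal_orthogonal_inf_fixFin_le_topologicalClosure_span_nice_three`** — the `hHead_level` currency:
  `(cuspidalSubspace μ 𝔓)ᗮ ⊓ (⨅ u : Kf, eigenspace (R (ι_f u)) 1) = (≤) closure span {nice LEFT-`ι_f(Kf)`-invariant classes}`, `Kf ≤ G(𝔸_f)` compact.
HONEST LABEL: HC_CM is proved only modulo the 7 printed citations (2 remaining named inputs: hLiu418 = `stmt-HodgeConjecture-24832`, h413 = `stmt-HodgeConjecture-24833`) until rung 0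
closes; REL ≠ ★ ≠ BUILT; this file asserts no named fact and closes no socket — (HEAD₃) stays OPEN modulo the N = 3 twins (m1)–(m5); count-neutral.

## References
* [MoeglinWaldspurger1995] C. Mœglin, J.-L. Waldspurger, *Spectral Decomposition and Eisenstein Series* (1995), II.1.1–II.1.4, II.1.12, II.2.4.
* [DeitmarEchterhoff2014] A. Deitmar, S. Echterhoff, *Principles of Harmonic Analysis* (2nd ed., 2014), Prop. 1.5.6, Lemma 7.2.6.
* [BorelJacquet1979] A. Borel, H. Jacquet, *Automorphic forms and automorphic representations*, Corvallis PSPM 33.1 (1979), §4.1, §4.6.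
-/

set_option autoImplicit false
set_option linter.dupNamespace false  -- the mandated namespace `…HodgeConjecture.HodgeConjecture.R90.S8` (LEAD #1 L1) repeats the summit's segment

noncomputable section

open MeasureTheory Measure Set Filter Topology NumberField
open Literature.MeasureTheory.Group Literature.NumberTheory.Automorphic Literature.NumberTheory.Automorphic.UnitaryGroup Literature.NumberTheory.GaloisRepresentations AdelicGroupData ContRepresentation
open Summit.HodgeConjecture.HodgeConjecture.Cruxes.H413.K2E1PseudoEisensteinNiceGeneratorsKTypeU (orthogonal_inf_iInf_eigenspace_eq_topologicalClosure_span_nice)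
open Summit.HodgeConjecture.HodgeConjecture.Cruxes.H413.K2E1PseudoEisensteinFamilyDecompositionOpenCosetsNamedU2 (exists_haar_probability_invariant)
open scoped ENNReal NNReal Pointwise

namespace Summit.HodgeConjecture.HodgeConjecture.R90.S8

variable (L : Type) [Field L] [NumberField L] [IsCMField L]
  (μ : Measure (quasiSplit (↥(maximalRealSubfield L)) L (IsCMField.complexConj L) 3).automorphicQuotient)

/-! ## §1 The Heisenberg radical is closed -/

omit [IsCMField L] in
/-- **The Heisenberg radical `N(𝔸) = val⁻¹(upper unitriangular) ≤ U(2,1)(𝔸_{L⁺})` is CLOSED** (★ `isClosed_upperUnitriangular` pulled back along the continuous `adelicVal`; the N = 3 reading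
of ★ `isClosed_adelicUnipotent_quasiSplit_cm`). [cite: BorelJacquet1979, §4.1] -/
theorem isClosed_coe_adelicUnipotent_three (F : Type) [Field F] [NumberField F] [Algebra F L] (c : L ≃ₐ[F] L) :
    IsClosed ((adelicUnipotent F L c 3 : Subgroup (quasiSplit F L c 3).Adelic) : Set (quasiSplit F L c 3).Adelic) := by
  haveI := t2Space_adeleRing_of_numberField L
  change IsClosed (⇑(adelicVal F L c 3 ((StdForm.antidiagonal 3).over L)) ⁻¹'
    ((Literature.NumberTheory.Automorphic.upperUnitriangular (Fin 3) (AdeleRing (𝓞 L) L) : Subgroup (GL (Fin 3) (AdeleRing (𝓞 L) L))) : Set (GL (Fin 3) (AdeleRing (𝓞 L) L))))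
  exact (Literature.NumberTheory.Automorphic.isClosed_upperUnitriangular (R := AdeleRing (𝓞 L) L)).preimage continuous_subtype_val

/-! ## §2 The `hP1τ` letter at a compact level of `U(2,1)_{L∕L⁺}` -/

/-- **`(L²_cusp(𝔓))ᗮ ⊓ L²(X)^{(K′,ω)} = closure span Θ^{ω,nice}(𝔓, K′)` AT A COMPACT LEVEL OF `U(2,1)_{L∕L⁺}`**: for a Borel datum `𝔓` of `quasiSplit L⁺ L c 3` (`Nonempty 𝔓.ι`, radicals `= N(𝔸)`),
a COMPACT `K′ ≤ G(𝔸)` and a CONTINUOUS unitary character `ω : K′ →* ℂ`: `(L²_cusp(𝔓))ᗮ ⊓ ⨅_{k ∈ K′} eigenspace(R k, ω k)` is the closed span of the classes `[θ_Ψ]` of NICE test functions —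
`Ψ` Borel, right-`N(𝔸)`-invariant, `∫⁻ θ_{‖Ψ‖}² < ∞`, continuous, bounded, `Ψ = 0` off `C·N(𝔸)` (`C` compact), `Ψ(k h) = ω(k)⁻¹ Ψ(h)` (`k ∈ K′`).  ★ P1b_τ
`orthogonal_inf_iInf_eigenspace_eq_topologicalClosure_span_nice` for the compact group `↥K′` through `K′.subtype` with its invariant Haar probability (★ `exists_haar_probability_invariant`),
Mathlib's Haar measure on `G(𝔸)`, closed radicals (§1), over the ★ N = 3 bridge `orthogonal_eq_topologicalClosure_span_of_borel_three` — the N = 3 twin of ★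
`cuspidal_orthogonal_inf_isotypic_eq_topologicalClosure_span_nice_of_isCompact`. [cite: MoeglinWaldspurger1995, II.1.1–II.1.4, II.1.12] [cite: DeitmarEchterhoff2014, Prop. 1.5.6, Lemma 7.2.6] -/
theorem cuspidal_orthogonal_inf_isotypic_eq_topologicalClosure_span_nice_of_isCompact_three
    (𝔓 : (quasiSplit (↥(maximalRealSubfield L)) L (IsCMField.complexConj L) 3).ParabolicUnipotentData) (hne : Nonempty 𝔓.ι) (h𝔓 : ∀ i : 𝔓.ι, 𝔓.radical i = adelicUnipotent (↥(maximalRealSubfield L)) L (IsCMField.complexConj L) 3)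
    [MeasurableSpace (quasiSplit (↥(maximalRealSubfield L)) L (IsCMField.complexConj L) 3).Adelic] [BorelSpace (quasiSplit (↥(maximalRealSubfield L)) L (IsCMField.complexConj L) 3).Adelic] [(quasiSplit (↥(maximalRealSubfield L)) L (IsCMField.complexConj L) 3).IsAutomorphicMeasure μ]
    (K' : Subgroup (quasiSplit (↥(maximalRealSubfield L)) L (IsCMField.complexConj L) 3).Adelic) (hK'c : IsCompact (K' : Set (quasiSplit (↥(maximalRealSubfield L)) L (IsCMField.complexConj L) 3).Adelic)) (ω : ↥K' →* ℂ) (hω1 : ∀ k : ↥K', ‖ω k‖ = 1) (hωc : Continuous ω) :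
    ((quasiSplit (↥(maximalRealSubfield L)) L (IsCMField.complexConj L) 3).cuspidalSubspace μ 𝔓).toSubmoduleᗮ ⊓ (⨅ k : ↥(K'), Module.End.eigenspace ((((quasiSplit (↥(maximalRealSubfield L)) L (IsCMField.complexConj L) 3).rightRegular μ) ((K').subtype k) : (quasiSplit (↥(maximalRealSubfield L)) L (IsCMField.complexConj L) 3).L2 μ →L[ℂ] (quasiSplit (↥(maximalRealSubfield L)) L (IsCMField.complexConj L) 3).L2 μ) :
          (quasiSplit (↥(maximalRealSubfield L)) L (IsCMField.complexConj L) 3).L2 μ →ₗ[ℂ] (quasiSplit (↥(maximalRealSubfield L)) L (IsCMField.complexConj L) 3).L2 μ) ((ω) k)) =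
      (Submodule.span ℂ {f : (quasiSplit (↥(maximalRealSubfield L)) L (IsCMField.complexConj L) 3).L2 μ | ∃ (i : 𝔓.ι) (Φ : (quasiSplit (↥(maximalRealSubfield L)) L (IsCMField.complexConj L) 3).Adelic → ℂ) (_ : Measurable Φ)
        (_ : ∀ (g : (quasiSplit (↥(maximalRealSubfield L)) L (IsCMField.complexConj L) 3).Adelic) (n : 𝔓.radical i), Φ (g * n) = Φ g)
        (_ : ∫⁻ x, (∑' q : (quasiSplit (↥(maximalRealSubfield L)) L (IsCMField.complexConj L) 3).quotientSubgroup ⧸ (𝔓.radical i).subgroupOf (quasiSplit (↥(maximalRealSubfield L)) L (IsCMField.complexConj L) 3).quotientSubgroup,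
          ‖Φ ((Quotient.out x : (quasiSplit (↥(maximalRealSubfield L)) L (IsCMField.complexConj L) 3).Adelic) * ((q.out : (quasiSplit (↥(maximalRealSubfield L)) L (IsCMField.complexConj L) 3).quotientSubgroup) : (quasiSplit (↥(maximalRealSubfield L)) L (IsCMField.complexConj L) 3).Adelic))‖ₑ) ^ 2 ∂μ < ∞)
        (_ : Continuous Φ) (_ : ∃ M : ℝ, ∀ g, ‖Φ g‖ ≤ M) (_ : ∃ C : Set (quasiSplit (↥(maximalRealSubfield L)) L (IsCMField.complexConj L) 3).Adelic, IsCompact C ∧ ∀ g, g ∉ C * ((𝔓.radical i : Subgroup (quasiSplit (↥(maximalRealSubfield L)) L (IsCMField.complexConj L) 3).Adelic) : Set (quasiSplit (↥(maximalRealSubfield L)) L (IsCMField.complexConj L) 3).Adelic) → Φ g = 0)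
        (_ : ∀ (k : ↥(K')) (h : (quasiSplit (↥(maximalRealSubfield L)) L (IsCMField.complexConj L) 3).Adelic), Φ ((K').subtype k * h) = ((ω) k)⁻¹ * Φ h)
        (hθ : MemLp (fun x : (quasiSplit (↥(maximalRealSubfield L)) L (IsCMField.complexConj L) 3).automorphicQuotient => ∑' q : (quasiSplit (↥(maximalRealSubfield L)) L (IsCMField.complexConj L) 3).quotientSubgroup ⧸ (𝔓.radical i).subgroupOf (quasiSplit (↥(maximalRealSubfield L)) L (IsCMField.complexConj L) 3).quotientSubgroup,
          Φ ((Quotient.out x : (quasiSplit (↥(maximalRealSubfield L)) L (IsCMField.complexConj L) 3).Adelic) * ((q.out : (quasiSplit (↥(maximalRealSubfield L)) L (IsCMField.complexConj L) 3).quotientSubgroup) : (quasiSplit (↥(maximalRealSubfield L)) L (IsCMField.complexConj L) 3).Adelic))) 2 μ), f = hθ.toLp _}).topologicalClosure := by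
  haveI := t2Space_adeleRing_of_numberField L
  haveI := locallyCompactSpace_adeleRing' L
  haveI := secondCountableTopology_adeleRing L
  haveI : LocallyCompactSpace (quasiSplit (↥(maximalRealSubfield L)) L (IsCMField.complexConj L) 3).Adelic := inferInstanceAs (LocallyCompactSpace (adelic (↥(maximalRealSubfield L)) L (IsCMField.complexConj L) 3 ((StdForm.antidiagonal 3).over L)))
  haveI : SecondCountableTopology (quasiSplit (↥(maximalRealSubfield L)) L (IsCMField.complexConj L) 3).Adelic := inferInstanceAs (SecondCountableTopology (adelic (↥(maximalRealSubfield L)) L (IsCMField.complexConj L) 3 ((StdForm.antidiagonal 3).over L)))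
  haveI : T2Space (quasiSplit (↥(maximalRealSubfield L)) L (IsCMField.complexConj L) 3).Adelic := inferInstanceAs (T2Space (adelic (↥(maximalRealSubfield L)) L (IsCMField.complexConj L) 3 ((StdForm.antidiagonal 3).over L)))
  haveI : DiscreteTopology (quasiSplit (↥(maximalRealSubfield L)) L (IsCMField.complexConj L) 3).quotientSubgroup := by
    rw [quotientSubgroup_quasiSplit]; exact isDiscreteRational_quasiSplit
  haveI : CompactSpace ↥K' := isCompact_iff_compactSpace.1 hK'c
  obtain ⟨μK, hμK1, hμKl, hμKr, hμKi⟩ := exists_haar_probability_invariant ↥K'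
  have hN : ∀ i : 𝔓.ι, IsClosed ((𝔓.radical i : Subgroup (quasiSplit (↥(maximalRealSubfield L)) L (IsCMField.complexConj L) 3).Adelic) : Set (quasiSplit (↥(maximalRealSubfield L)) L (IsCMField.complexConj L) 3).Adelic) := fun i => by
    rw [h𝔓 i]; exact isClosed_coe_adelicUnipotent_three L (↥(maximalRealSubfield L)) (IsCMField.complexConj L)
  exact orthogonal_inf_iInf_eigenspace_eq_topologicalClosure_span_nice (quasiSplit (↥(maximalRealSubfield L)) L (IsCMField.complexConj L) 3) 𝔓 μ Measure.haar μK K'.subtype ω hN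
    continuous_subtype_val hω1 hωc ((quasiSplit (↥(maximalRealSubfield L)) L (IsCMField.complexConj L) 3).cuspidalSubspace μ 𝔓) rfl rfl rfl (orthogonal_eq_topologicalClosure_span_of_borel_three L 𝔓 hne h𝔓 μ)

/-! ## §3 The `hHead_level` currency: `Fix(ι_f Kf) = ⨅_{u ∈ Kf} eigenspace(R(ι_f u), 1)`, nice LEFT-`ι_f(Kf)`-invariant classes -/

/-- **`(L²_cusp(𝔓))ᗮ ⊓ Fix(ι_f Kf) = closure span Θ^{nice, ι_f(Kf)}(𝔓)`** for every COMPACT `Kf ≤ U(2,1)(𝔸_{L⁺,f})`: the left side of ★ `hHead_kType_of_level_three`'s binder `hHead_level`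
(verbatim its `⨅ u : Kf, eigenspace (R (ι_f u)) 1`) EQUALS the closed span of the classes `[θ_Ψ]` of NICE test functions that are LEFT-`ι_f(Kf)`-INVARIANT (`Ψ(ι_f(u) h) = Ψ(h)`, `u ∈ Kf`) —
§2 at `K′ := Kf.map ι_f` (compact: continuous image, ★ `continuous_finAdelicToAdelic`), `ω := 1`, the infimum re-indexed along `Kf ↠ ι_f(Kf)` (Mathlib `Function.Surjective.iInf_comp`).  So
(HEAD₃) is exactly «every nice left-`ι_f(Kf)`-invariant class lies in `cl ⨆_b resGBlock L μ (Kf.map ι_f) 1 (χ₁ b) (χ₂ b)`» — the N = 3 generator core, census (m1)–(m5).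
[cite: MoeglinWaldspurger1995, II.1.1–II.1.4, II.2.4] [cite: DeitmarEchterhoff2014, Lemma 7.2.6] -/
theorem cuspidal_orthogonal_inf_fixFin_eq_topologicalClosure_span_nice_three
    (𝔓 : (quasiSplit (↥(maximalRealSubfield L)) L (IsCMField.complexConj L) 3).ParabolicUnipotentData) (hne : Nonempty 𝔓.ι) (h𝔓 : ∀ i : 𝔓.ι, 𝔓.radical i = adelicUnipotent (↥(maximalRealSubfield L)) L (IsCMField.complexConj L) 3)
    [MeasurableSpace (quasiSplit (↥(maximalRealSubfield L)) L (IsCMField.complexConj L) 3).Adelic] [BorelSpace (quasiSplit (↥(maximalRealSubfield L)) L (IsCMField.complexConj L) 3).Adelic] [(quasiSplit (↥(maximalRealSubfield L)) L (IsCMField.complexConj L) 3).IsAutomorphicMeasure μ]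
    (Kf : Subgroup ↥(finAdelic (↥(maximalRealSubfield L)) L (IsCMField.complexConj L) 3 ((StdForm.antidiagonal 3).over L)))
    (hKfc : IsCompact ((Kf : Subgroup ↥(finAdelic (↥(maximalRealSubfield L)) L (IsCMField.complexConj L) 3 ((StdForm.antidiagonal 3).over L))) : Set ↥(finAdelic (↥(maximalRealSubfield L)) L (IsCMField.complexConj L) 3 ((StdForm.antidiagonal 3).over L)))) :
    ((quasiSplit (↥(maximalRealSubfield L)) L (IsCMField.complexConj L) 3).cuspidalSubspace μ 𝔓).toSubmoduleᗮ ⊓ (⨅ u : ↥(Kf), Module.End.eigenspace ((((quasiSplit (↥(maximalRealSubfield L)) L (IsCMField.complexConj L) 3).rightRegular μ) (finAdelicToAdelic (↥(maximalRealSubfield L)) L (IsCMField.complexConj L) 3 ((StdForm.antidiagonal 3).over L) (u : ↥(finAdelic (↥(maximalRealSubfield L)) L (IsCMField.complexConj L) 3 ((StdForm.antidiagonal 3).over L)))) :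
        (quasiSplit (↥(maximalRealSubfield L)) L (IsCMField.complexConj L) 3).L2 μ →L[ℂ] (quasiSplit (↥(maximalRealSubfield L)) L (IsCMField.complexConj L) 3).L2 μ) : (quasiSplit (↥(maximalRealSubfield L)) L (IsCMField.complexConj L) 3).L2 μ →ₗ[ℂ] (quasiSplit (↥(maximalRealSubfield L)) L (IsCMField.complexConj L) 3).L2 μ) 1) =
      (Submodule.span ℂ {f : (quasiSplit (↥(maximalRealSubfield L)) L (IsCMField.complexConj L) 3).L2 μ | ∃ (i : 𝔓.ι) (Φ : (quasiSplit (↥(maximalRealSubfield L)) L (IsCMField.complexConj L) 3).Adelic → ℂ) (_ : Measurable Φ)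
        (_ : ∀ (g : (quasiSplit (↥(maximalRealSubfield L)) L (IsCMField.complexConj L) 3).Adelic) (n : 𝔓.radical i), Φ (g * n) = Φ g)
        (_ : ∫⁻ x, (∑' q : (quasiSplit (↥(maximalRealSubfield L)) L (IsCMField.complexConj L) 3).quotientSubgroup ⧸ (𝔓.radical i).subgroupOf (quasiSplit (↥(maximalRealSubfield L)) L (IsCMField.complexConj L) 3).quotientSubgroup,
          ‖Φ ((Quotient.out x : (quasiSplit (↥(maximalRealSubfield L)) L (IsCMField.complexConj L) 3).Adelic) * ((q.out : (quasiSplit (↥(maximalRealSubfield L)) L (IsCMField.complexConj L) 3).quotientSubgroup) : (quasiSplit (↥(maximalRealSubfield L)) L (IsCMField.complexConj L) 3).Adelic))‖ₑ) ^ 2 ∂μ < ∞)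
        (_ : Continuous Φ) (_ : ∃ M : ℝ, ∀ g, ‖Φ g‖ ≤ M) (_ : ∃ C : Set (quasiSplit (↥(maximalRealSubfield L)) L (IsCMField.complexConj L) 3).Adelic, IsCompact C ∧ ∀ g, g ∉ C * ((𝔓.radical i : Subgroup (quasiSplit (↥(maximalRealSubfield L)) L (IsCMField.complexConj L) 3).Adelic) : Set (quasiSplit (↥(maximalRealSubfield L)) L (IsCMField.complexConj L) 3).Adelic) → Φ g = 0)
        (_ : ∀ (u : ↥(Kf)) (h : (quasiSplit (↥(maximalRealSubfield L)) L (IsCMField.complexConj L) 3).Adelic), Φ (finAdelicToAdelic (↥(maximalRealSubfield L)) L (IsCMField.complexConj L) 3 ((StdForm.antidiagonal 3).over L) (u : ↥(finAdelic (↥(maximalRealSubfield L)) L (IsCMField.complexConj L) 3 ((StdForm.antidiagonal 3).over L))) * h) = Φ h)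
        (hθ : MemLp (fun x : (quasiSplit (↥(maximalRealSubfield L)) L (IsCMField.complexConj L) 3).automorphicQuotient => ∑' q : (quasiSplit (↥(maximalRealSubfield L)) L (IsCMField.complexConj L) 3).quotientSubgroup ⧸ (𝔓.radical i).subgroupOf (quasiSplit (↥(maximalRealSubfield L)) L (IsCMField.complexConj L) 3).quotientSubgroup,
          Φ ((Quotient.out x : (quasiSplit (↥(maximalRealSubfield L)) L (IsCMField.complexConj L) 3).Adelic) * ((q.out : (quasiSplit (↥(maximalRealSubfield L)) L (IsCMField.complexConj L) 3).quotientSubgroup) : (quasiSplit (↥(maximalRealSubfield L)) L (IsCMField.complexConj L) 3).Adelic))) 2 μ), f = hθ.toLp _}).topologicalClosure := by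
  -- the compact image level `K′ := ι_f(Kf) ≤ G(𝔸)` and the trivial character
  set K' : Subgroup (quasiSplit (↥(maximalRealSubfield L)) L (IsCMField.complexConj L) 3).Adelic := Kf.map (finAdelicToAdelic (↥(maximalRealSubfield L)) L (IsCMField.complexConj L) 3 ((StdForm.antidiagonal 3).over L)) with hK'
  have hK'c : IsCompact (K' : Set (quasiSplit (↥(maximalRealSubfield L)) L (IsCMField.complexConj L) 3).Adelic) := by
    rw [hK', Subgroup.coe_map]
    exact hKfc.image (continuous_finAdelicToAdelic (↥(maximalRealSubfield L)) L (IsCMField.complexConj L) 3 ((StdForm.antidiagonal 3).over L))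
  have hmain := cuspidal_orthogonal_inf_isotypic_eq_topologicalClosure_span_nice_of_isCompact_three L μ 𝔓 hne h𝔓 K' hK'c (1 : ↥K' →* ℂ)
    (fun k => by rw [MonoidHom.one_apply, norm_one]) ((continuous_const (y := (1 : ℂ))).congr fun k => (MonoidHom.one_apply k).symm)
  -- re-index the isotypic infimum along `Kf ↠ ι_f(Kf)` and read `ω = 1`
  set ι : ↥Kf → ↥K' := fun u => ⟨finAdelicToAdelic (↥(maximalRealSubfield L)) L (IsCMField.complexConj L) 3 ((StdForm.antidiagonal 3).over L) (u : ↥(finAdelic (↥(maximalRealSubfield L)) L (IsCMField.complexConj L) 3 ((StdForm.antidiagonal 3).over L))),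
    hK' ▸ Subgroup.mem_map_of_mem _ u.2⟩ with hι
  have hιs : Function.Surjective ι := by
    rintro ⟨k, hk⟩
    have hk' : k ∈ Kf.map (finAdelicToAdelic (↥(maximalRealSubfield L)) L (IsCMField.complexConj L) 3 ((StdForm.antidiagonal 3).over L)) := hK' ▸ hk
    obtain ⟨u, hu, rfl⟩ := Subgroup.mem_map.1 hk'
    exact ⟨⟨u, hu⟩, rfl⟩
  have hinf : (⨅ u : ↥(Kf), Module.End.eigenspace ((((quasiSplit (↥(maximalRealSubfield L)) L (IsCMField.complexConj L) 3).rightRegular μ) (finAdelicToAdelic (↥(maximalRealSubfield L)) L (IsCMField.complexConj L) 3 ((StdForm.antidiagonal 3).over L) (u : ↥(finAdelic (↥(maximalRealSubfield L)) L (IsCMField.complexConj L) 3 ((StdForm.antidiagonal 3).over L)))) :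
        (quasiSplit (↥(maximalRealSubfield L)) L (IsCMField.complexConj L) 3).L2 μ →L[ℂ] (quasiSplit (↥(maximalRealSubfield L)) L (IsCMField.complexConj L) 3).L2 μ) : (quasiSplit (↥(maximalRealSubfield L)) L (IsCMField.complexConj L) 3).L2 μ →ₗ[ℂ] (quasiSplit (↥(maximalRealSubfield L)) L (IsCMField.complexConj L) 3).L2 μ) 1) =
      ⨅ k : ↥(K'), Module.End.eigenspace ((((quasiSplit (↥(maximalRealSubfield L)) L (IsCMField.complexConj L) 3).rightRegular μ) ((K').subtype k) : (quasiSplit (↥(maximalRealSubfield L)) L (IsCMField.complexConj L) 3).L2 μ →L[ℂ] (quasiSplit (↥(maximalRealSubfield L)) L (IsCMField.complexConj L) 3).L2 μ) :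
          (quasiSplit (↥(maximalRealSubfield L)) L (IsCMField.complexConj L) 3).L2 μ →ₗ[ℂ] (quasiSplit (↥(maximalRealSubfield L)) L (IsCMField.complexConj L) 3).L2 μ) ((1 : ↥K' →* ℂ) k) := by
    rw [← hιs.iInf_comp]
    rfl
  rw [hinf, hmain]
  -- the two nice generating sets coincide (`1⁻¹ • Φ = Φ`; every `k ∈ ι_f(Kf)` is some `ι_f u`)
  congr 2
  ext f
  constructor
  · rintro ⟨i, Φ, hΦm, hΦ, h2, hc, hM, hC, hK, hθ, rfl⟩
    refine ⟨i, Φ, hΦm, hΦ, h2, hc, hM, hC, fun u h => ?_, hθ, rfl⟩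
    have h1 := hK (ι u) h
    rwa [MonoidHom.one_apply, inv_one, one_mul] at h1
  · rintro ⟨i, Φ, hΦm, hΦ, h2, hc, hM, hC, hK, hθ, rfl⟩
    refine ⟨i, Φ, hΦm, hΦ, h2, hc, hM, hC, fun k h => ?_, hθ, rfl⟩
    obtain ⟨u, rfl⟩ := hιs k
    rw [MonoidHom.one_apply, inv_one, one_mul]
    exact hK u h

/-- **THE `≤` HALF IN `hHead_level`'s CURRENCY**: `(L²_cusp(𝔓))ᗮ ⊓ Fix(ι_f Kf) ≤ closure span Θ^{nice, ι_f(Kf)}(𝔓)` for every compact `Kf ≤ U(2,1)(𝔸_{L⁺,f})` — so the binder `hHead_level` of ★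
`hHead_kType_of_level_three` FOLLOWS from «`Θ^{nice, ι_f(Kf)}(𝔓) ⊆ cl ⨆_b resGBlock L μ (Kf.map ι_f) 1 (χ₁ b) (χ₂ b)`» (closure of a span is monotone and idempotent) — the N = 3 generator core
(census (m1)–(m5)), which is where (HEAD₃) now honestly stands. [cite: MoeglinWaldspurger1995, II.2.4] -/
theorem cuspidal_orthogonal_inf_fixFin_le_topologicalClosure_span_nice_three
    (𝔓 : (quasiSplit (↥(maximalRealSubfield L)) L (IsCMField.complexConj L) 3).ParabolicUnipotentData) (hne : Nonempty 𝔓.ι) (h𝔓 : ∀ i : 𝔓.ι, 𝔓.radical i = adelicUnipotent (↥(maximalRealSubfield L)) L (IsCMField.complexConj L) 3)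
    [MeasurableSpace (quasiSplit (↥(maximalRealSubfield L)) L (IsCMField.complexConj L) 3).Adelic] [BorelSpace (quasiSplit (↥(maximalRealSubfield L)) L (IsCMField.complexConj L) 3).Adelic] [(quasiSplit (↥(maximalRealSubfield L)) L (IsCMField.complexConj L) 3).IsAutomorphicMeasure μ]
    (Kf : Subgroup ↥(finAdelic (↥(maximalRealSubfield L)) L (IsCMField.complexConj L) 3 ((StdForm.antidiagonal 3).over L)))
    (hKfc : IsCompact ((Kf : Subgroup ↥(finAdelic (↥(maximalRealSubfield L)) L (IsCMField.complexConj L) 3 ((StdForm.antidiagonal 3).over L))) : Set ↥(finAdelic (↥(maximalRealSubfield L)) L (IsCMField.complexConj L) 3 ((StdForm.antidiagonal 3).over L)))) :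
    ((quasiSplit (↥(maximalRealSubfield L)) L (IsCMField.complexConj L) 3).cuspidalSubspace μ 𝔓).toSubmoduleᗮ ⊓ (⨅ u : ↥(Kf), Module.End.eigenspace ((((quasiSplit (↥(maximalRealSubfield L)) L (IsCMField.complexConj L) 3).rightRegular μ) (finAdelicToAdelic (↥(maximalRealSubfield L)) L (IsCMField.complexConj L) 3 ((StdForm.antidiagonal 3).over L) (u : ↥(finAdelic (↥(maximalRealSubfield L)) L (IsCMField.complexConj L) 3 ((StdForm.antidiagonal 3).over L)))) :
        (quasiSplit (↥(maximalRealSubfield L)) L (IsCMField.complexConj L) 3).L2 μ →L[ℂ] (quasiSplit (↥(maximalRealSubfield L)) L (IsCMField.complexConj L) 3).L2 μ) : (quasiSplit (↥(maximalRealSubfield L)) L (IsCMField.complexConj L) 3).L2 μ →ₗ[ℂ] (quasiSplit (↥(maximalRealSubfield L)) L (IsCMField.complexConj L) 3).L2 μ) 1) ≤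
      (Submodule.span ℂ {f : (quasiSplit (↥(maximalRealSubfield L)) L (IsCMField.complexConj L) 3).L2 μ | ∃ (i : 𝔓.ι) (Φ : (quasiSplit (↥(maximalRealSubfield L)) L (IsCMField.complexConj L) 3).Adelic → ℂ) (_ : Measurable Φ)
        (_ : ∀ (g : (quasiSplit (↥(maximalRealSubfield L)) L (IsCMField.complexConj L) 3).Adelic) (n : 𝔓.radical i), Φ (g * n) = Φ g)
        (_ : ∫⁻ x, (∑' q : (quasiSplit (↥(maximalRealSubfield L)) L (IsCMField.complexConj L) 3).quotientSubgroup ⧸ (𝔓.radical i).subgroupOf (quasiSplit (↥(maximalRealSubfield L)) L (IsCMField.complexConj L) 3).quotientSubgroup,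
          ‖Φ ((Quotient.out x : (quasiSplit (↥(maximalRealSubfield L)) L (IsCMField.complexConj L) 3).Adelic) * ((q.out : (quasiSplit (↥(maximalRealSubfield L)) L (IsCMField.complexConj L) 3).quotientSubgroup) : (quasiSplit (↥(maximalRealSubfield L)) L (IsCMField.complexConj L) 3).Adelic))‖ₑ) ^ 2 ∂μ < ∞)
        (_ : Continuous Φ) (_ : ∃ M : ℝ, ∀ g, ‖Φ g‖ ≤ M) (_ : ∃ C : Set (quasiSplit (↥(maximalRealSubfield L)) L (IsCMField.complexConj L) 3).Adelic, IsCompact C ∧ ∀ g, g ∉ C * ((𝔓.radical i : Subgroup (quasiSplit (↥(maximalRealSubfield L)) L (IsCMField.complexConj L) 3).Adelic) : Set (quasiSplit (↥(maximalRealSubfield L)) L (IsCMField.complexConj L) 3).Adelic) → Φ g = 0)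
        (_ : ∀ (u : ↥(Kf)) (h : (quasiSplit (↥(maximalRealSubfield L)) L (IsCMField.complexConj L) 3).Adelic), Φ (finAdelicToAdelic (↥(maximalRealSubfield L)) L (IsCMField.complexConj L) 3 ((StdForm.antidiagonal 3).over L) (u : ↥(finAdelic (↥(maximalRealSubfield L)) L (IsCMField.complexConj L) 3 ((StdForm.antidiagonal 3).over L))) * h) = Φ h)
        (hθ : MemLp (fun x : (quasiSplit (↥(maximalRealSubfield L)) L (IsCMField.complexConj L) 3).automorphicQuotient => ∑' q : (quasiSplit (↥(maximalRealSubfield L)) L (IsCMField.complexConj L) 3).quotientSubgroup ⧸ (𝔓.radical i).subgroupOf (quasiSplit (↥(maximalRealSubfield L)) L (IsCMField.complexConj L) 3).quotientSubgroup,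
          Φ ((Quotient.out x : (quasiSplit (↥(maximalRealSubfield L)) L (IsCMField.complexConj L) 3).Adelic) * ((q.out : (quasiSplit (↥(maximalRealSubfield L)) L (IsCMField.complexConj L) 3).quotientSubgroup) : (quasiSplit (↥(maximalRealSubfield L)) L (IsCMField.complexConj L) 3).Adelic))) 2 μ), f = hθ.toLp _}).topologicalClosure :=
  (cuspidal_orthogonal_inf_fixFin_eq_topologicalClosure_span_nice_three L μ 𝔓 hne h𝔓 Kf hKfc).le

end Summit.HodgeConjecture.HodgeConjecture.R90.S8

end
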